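import Summits.CriticalPhenomena.PercolationContinuityZ3.Theorems.Transplant.BccClawX2Table
import HarnessLib

/-!
# The bcc (001)-slabs, exit-form routing certificate for THICKNESS `k = 2`, IIIA: the parity-aware planar claw rule `clawX2` SUCCEEDS — centre parity
# `ε = 0`, clip classes `(3, 3, 0, 0)`, `(3, 3, 0, 1)`, `(3, 3, 0, 2)`, `(3, 3, 0, 3)`, `(3, 3, 0, 4)`, `(3, 3, 1, 1)`, `(3, 3, 1, 2)` (kernel computation)

builds on p205010 (kernel theorem, internal audit signed; external expert review pending) — NOT used in this file.
Lane `prim-bschramm`, seat `prim-bschramm-p2` (gen 47; class C1b, METHOD = input substitution; memo `HOME/bschramm/P2-LATTICES.md` §157); helper file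
(`--supports stmt-CriticalPhenomena-4575 --as helper`).  One `decide +kernel` theorem per centre parity `ε` and clip class `(t_R, t_D, s_R, s_D)` with
`t_R = 3` of «BccClawX2Table».`ClawX2OK` (standard axioms, no `native_decide`); the classes with `t_R < 3` (hence `s_R = 3`) follow by the diagonal
mirror in «BccClawX2Sound» (the mirror preserves `ε`).  The eight files «BccClawX2TableOK{A,…,H}» together cover both parities and the `28` classes
`t_D ∈ {3, 4}`, `s_R ≤ s_D ≤ 4`, `s_R ≤ 3` (`117 459` admissible configurations; the table was found by the kit job `j339043` and is only verified here).
[cite: DuminilCopinSidoraviciusTassion2016, §2.3 (proof of Fact 2: the three disjoint paths in B̄_R(z))]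
-/

namespace Summit.CriticalPhenomena.PercolationContinuityZ3.Theorems.Transplant

namespace BccClawX

/-- Centre parity `ε = 0`, clip class `(t_R, t_D, s_R, s_D) = (3, 3, 0, 0)`. [folklore] -/
theorem clawX2OK_e0_3300 : ClawX2OK 0 3 3 0 0 := by unfold ClawX2OK; decide +kernel

/-- Centre parity `ε = 0`, clip class `(t_R, t_D, s_R, s_D) = (3, 3, 0, 1)`. [folklore] -/
theorem clawX2OK_e0_3301 : ClawX2OK 0 3 3 0 1 := by unfold ClawX2OK; decide +kernel

/-- Centre parity `ε = 0`, clip class `(t_R, t_D, s_R, s_D) = (3, 3, 0, 2)`. [folklore] -/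
theorem clawX2OK_e0_3302 : ClawX2OK 0 3 3 0 2 := by unfold ClawX2OK; decide +kernel

/-- Centre parity `ε = 0`, clip class `(t_R, t_D, s_R, s_D) = (3, 3, 0, 3)`. [folklore] -/
theorem clawX2OK_e0_3303 : ClawX2OK 0 3 3 0 3 := by unfold ClawX2OK; decide +kernel

/-- Centre parity `ε = 0`, clip class `(t_R, t_D, s_R, s_D) = (3, 3, 0, 4)`. [folklore] -/
theorem clawX2OK_e0_3304 : ClawX2OK 0 3 3 0 4 := by unfold ClawX2OK; decide +kernel

/-- Centre parity `ε = 0`, clip class `(t_R, t_D, s_R, s_D) = (3, 3, 1, 1)`. [folklore] -/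
theorem clawX2OK_e0_3311 : ClawX2OK 0 3 3 1 1 := by unfold ClawX2OK; decide +kernel

/-- Centre parity `ε = 0`, clip class `(t_R, t_D, s_R, s_D) = (3, 3, 1, 2)`. [folklore] -/
theorem clawX2OK_e0_3312 : ClawX2OK 0 3 3 1 2 := by unfold ClawX2OK; decide +kernel

end BccClawX

end Summit.CriticalPhenomena.PercolationContinuityZ3.Theorems.Transplant
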